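import Literature.AnabelianGeometry.EtaleTheta.SettingModelTateMuTwoCLevel
import Literature.AnabelianGeometry.EtaleTheta.SettingModelTateThetaCusp
import HarnessLib

/-!
# The Def. 1.7 layer of [EtTh] §1 over the STAGE-2 («Tate shear») model WITH A CUSP, file F8qc:
# `MuTwoSetting.modelχq′ p i j hj` and its C-level data

S. Mochizuki, *The étale theta function and its Frobenioid-theoretic manifestations*, Publ. RIMS **45** (2009)
[EtTh], §1, Def. 1.7 p. 27 ("`K = K̈`", "`C^log = X^log/±1`", "`Ẍ^log → X^log` … of degree 4", "`ε_μ`", "`ε_±`",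
"`ε_Z`"), p. 13 ("any decomposition group of a cusp of `Y^log`") [cite: MochizukiEtTh2009, Def 1.7 p.27].  Layer L2 of
the abc-iut cell, R78 cluster STAGE 2 (cusp lineage of abc-iut-w5-d029; abc-iut-w5-d249 g5 11:16:40Z «cusped twin F8c
pattern applies verbatim over curveχq′»): abc-iut-w5-d249's R244 records `MuTwoSetting.modelχq p i j hj`
(`SettingModelTateMuTwo`: `Π^tp_C := Π^tp_X ⋊_ι ℤ/2` for the cocycle-corrected stage-2 inversion `ι`,
`Π^tp_Ẍ := Ker parityχq`, `ε_μ := b`, `ε_± := (1, 1̄)`) and `MuTwoSetting.modelχq_cLevelData` (`SettingModelTateMuTwoCLevel`: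
`augC`, open embedding, admissible `ε_Z := a`) TRANSCRIBED over this seat's cusped stage-2 root
`ThetaSetting.modelχq′ p i j hj` (F5qc `SettingModelTateThetaCusp`, p437860: the SAME `Π^tp_X = Γ ⋊_{actχq} G_{ℚ_p}`, theta
quotients and coverings, plus ONE synthetic cusp with decomposition group `b^Ẑ ⋊ G_{ℚ_p}`).  Every field is R244's
verbatim; the carriers agree definitionally:

* `gtpYdd_modelχq'_le_Xddχq`; **`MuTwoSetting.modelχq′ p i j hj : MuTwoSetting p`** (`toThetaSetting := ThetaSetting.modelχq′`);
  `modelχq'_toThetaSetting`, `modelχq'_GtpC_inclX_GtpXdd`, `modelχq'_dotX_dotC` (`rfl` against R244);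
* `MuTwoSetting.modelχq'_isEtThOrigin`, `modelχq'_compat`, **`modelχq'_isAdmissibleEpsZ`** (R244's `epsZCq`),
  `modelχq'_epsPM_conj` (`ε_±` conjugates `Π^tp_X` by `ι`);
* **`MuTwoSetting.modelχq'_cLevelData : (MuTwoSetting.modelχq′ p i j hj).CLevelData`** (R244's fields), `nonempty_cLevelData_modelχq'`;
* the cusp at the MuTwo level: `exists_isCusp_muTwo_modelχq'`, `decomp_muTwo_modelχq'_eq` (= `cuspDecompχq p i j`);
* headline `MuTwoSetting.exists_tate_cLevelData_and_isCusp_and_isAdmissibleEpsZ` — for every `i` and even `j` a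
  `MuTwoSetting` over the cusped stage-2 carrier with C-level data, the guard, `Compat`, an admissible `ε_Z` and A CUSP.

HONEST LIMITS: semi-synthetic model (Tate-module type Galois action; the cusp is the Tate-twisted `b`-axis, `SettingModelCuspAxis`
— by this seat's `GalSectDotCCuspDecompCriterion` pattern the `DotCCusp` data of Thm. 1.10 (iii) are NOT expected over it);
consistency evidence for the typed interface only; nothing of [EtTh] asserted; no side taken on [IUTchIII] Cor. 3.12;
typed ≠ proved.  Class (b) construction (one `abbrev` record + one C-level data `def` over R244's carrier; no instance,
no Prop fact; R244 / F5qc untouched).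
-/

noncomputable section

namespace Literature.AnabelianGeometry.EtaleTheta.SettingModel

open Literature.AnabelianGeometry.SemiGraphs
open Function
open _root_.Topology

variable (p : ℕ) [Fact p.Prime] (i j : ℤ) (hj : Even j)

/-- `Π^tp_Ÿ ≤ Π^tp_Ẍ` at the CUSPED stage-2 model (the same subgroups of the same `Π^tp_X` as at `modelχq`).
[cite: MochizukiEtTh2009, Def 1.7 p.27] -/
theorem gtpYdd_modelχq'_le_Xddχq : (ThetaSetting.modelχq' p i j hj).GtpYdd ≤ Xddχq p i j hj :=
  GtpYdd_modelχq_le_Xddχq p i j hj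

/-- **The Def. 1.7 record over the stage-2 model WITH A CUSP** — abc-iut-w5-d249's `MuTwoSetting.modelχq p i j hj`
with `toThetaSetting := ThetaSetting.modelχq′ p i j hj`; every other field verbatim. Consistency evidence only.
[cite: MochizukiEtTh2009, Def 1.7 p.27] -/
abbrev _root_.Literature.AnabelianGeometry.EtaleTheta.MuTwoSetting.modelχq' : MuTwoSetting p where
  toThetaSetting := ThetaSetting.modelχq' p i j hj
  sqrtqX_mem_K := natCast_mem _ _
  GtpC := PiTpCq p i j
  inclX := SemidirectProduct.inl
  continuous_inclX := continuous_inlCq p i j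
  injective_inclX := SemidirectProduct.inl_injective
  isOpen_range_inclX := isOpen_range_inlCq p i j
  range_inclX_normal := by
    rw [range_inlCq]
    infer_instance
  index_range_inclX := index_range_inlCq p i j
  GtpXdd := Xddχq p i j hj
  index_GtpXdd := index_Xddχq p i j hj
  map_GtpXdd_normal := map_inl_Xddχq_normal p i j hj
  sq_mem_GtpXdd := sq_mem_map_inl_Xddχq p i j hj
  GtpYdd_le_GtpXdd := gtpYdd_modelχq'_le_Xddχq p i j hj
  epsMu := SemidirectProduct.inl (SemidirectProduct.inl (gfpOf (FreeGroup.of 1)))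
  epsMu_mem := ⟨_, rfl⟩
  epsMu_not_mem := by
    rintro ⟨y, hy, hyy⟩
    have h := SemidirectProduct.inl_injective hyy
    subst h
    exact inl_b_not_mem_Xddχq p i j hj hy
  epsPM := SemidirectProduct.inr (Multiplicative.ofAdd 1)
  epsPM_not_mem := by
    rintro ⟨y, hy⟩
    have h := congrArg (SemidirectProduct.rightHom (φ := invActionχq p i j)) hy
    rw [SemidirectProduct.rightHom_inl, SemidirectProduct.rightHom_inr] at h
    exact absurd h (by decide)

/-- The cusped Def. 1.7 record sits over the cusped stage-2 root record. [cite: MochizukiEtTh2009, Def 1.7 p.27] -/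
theorem _root_.Literature.AnabelianGeometry.EtaleTheta.MuTwoSetting.modelχq'_toThetaSetting :
    (MuTwoSetting.modelχq' p i j hj).toThetaSetting = ThetaSetting.modelχq' p i j hj := rfl

/-- `Π^tp_C`, `inclX`, `Π^tp_Ẍ`, `ε_μ`, `ε_±` of the cusped record are R244's (`rfl`). [cite: MochizukiEtTh2009, Def 1.7 p.27] -/
theorem _root_.Literature.AnabelianGeometry.EtaleTheta.MuTwoSetting.modelχq'_GtpC_inclX_GtpXdd :
    (MuTwoSetting.modelχq' p i j hj).GtpC = (MuTwoSetting.modelχq p i j hj).GtpC ∧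
      (MuTwoSetting.modelχq' p i j hj).inclX = (MuTwoSetting.modelχq p i j hj).inclX ∧
      (MuTwoSetting.modelχq' p i j hj).GtpXdd = (MuTwoSetting.modelχq p i j hj).GtpXdd ∧
      (MuTwoSetting.modelχq' p i j hj).epsMu = (MuTwoSetting.modelχq p i j hj).epsMu ∧
      (MuTwoSetting.modelχq' p i j hj).epsPM = (MuTwoSetting.modelχq p i j hj).epsPM :=
  ⟨rfl, rfl, rfl, rfl, rfl⟩

/-- `Π^tp_Ẋ`, `Π^tp_Ċ` of the cusped record are R244's. [cite: MochizukiEtTh2009, Def 1.7 p.27] -/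
theorem _root_.Literature.AnabelianGeometry.EtaleTheta.MuTwoSetting.modelχq'_dotX_dotC (εZ : PiTpCq p i j) :
    (MuTwoSetting.modelχq' p i j hj).dotX εZ = (MuTwoSetting.modelχq p i j hj).dotX εZ ∧
      (MuTwoSetting.modelχq' p i j hj).dotC εZ = (MuTwoSetting.modelχq p i j hj).dotC εZ :=
  ⟨rfl, rfl⟩

/-- … hence satisfies the guard `IsEtThOrigin`. [cite: MochizukiEtTh2009, §1 p.12] -/
theorem _root_.Literature.AnabelianGeometry.EtaleTheta.MuTwoSetting.modelχq'_isEtThOrigin :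
    (MuTwoSetting.modelχq' p i j hj).toThetaSetting.IsEtThOrigin :=
  ThetaSetting.modelχq'_isEtThOrigin p i j hj

/-- … and `Compat`. [cite: MochizukiEtTh2009, Prop 1.5 p.22] -/
theorem _root_.Literature.AnabelianGeometry.EtaleTheta.MuTwoSetting.modelχq'_compat :
    (MuTwoSetting.modelχq' p i j hj).toThetaSetting.Compat :=
  (ThetaSetting.modelχq' p i j hj).compat

/-- **`ε_Z := a` (R244's `epsZCq`) is admissible** at the cusped stage-2 record (same `Π^tp_C`, `Π^tp_Ẍ`, `ε_μ`).
[cite: MochizukiEtTh2009, Def 1.7 p.27] -/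
theorem _root_.Literature.AnabelianGeometry.EtaleTheta.MuTwoSetting.modelχq'_isAdmissibleEpsZ :
    (MuTwoSetting.modelχq' p i j hj).IsAdmissibleEpsZ (epsZCq p i j) :=
  MuTwoSetting.modelχq_isAdmissibleEpsZ p i j hj

/-- `ε_± · x · ε_±⁻¹ = ι x` for the cusped record. [cite: MochizukiEtTh2009, §2 p.36] -/
theorem _root_.Literature.AnabelianGeometry.EtaleTheta.MuTwoSetting.modelχq'_epsPM_conj (x : PiTpχq p i j) :
    (MuTwoSetting.modelχq' p i j hj).epsPM * (MuTwoSetting.modelχq' p i j hj).inclX x *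
        (MuTwoSetting.modelχq' p i j hj).epsPM⁻¹ =
      (MuTwoSetting.modelχq' p i j hj).inclX (inversionχq p i j x) :=
  epsPM_conj_inlCq p i j x

/-- **C-level data over the cusped stage-2 record** (R244's `augCq`, open embedding `inl`).
[cite: MochizukiEtTh2009, Def 1.7 p.27] -/
def _root_.Literature.AnabelianGeometry.EtaleTheta.MuTwoSetting.modelχq'_cLevelData :
    (MuTwoSetting.modelχq' p i j hj).CLevelData where
  isOpenEmbedding_inclX := isOpenEmbedding_inlCq p i j
  augC := augCq p i j
  augC_inclX := augCq_inl p i j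
  range_augC := by
    rw [range_augCq]
    exact (IntermediateField.fixingSubgroup_bot).symm

/-- Non-vacuity of the C-level data at the cusped stage-2 record. [cite: MochizukiEtTh2009, Def 1.7 p.27] -/
theorem _root_.Literature.AnabelianGeometry.EtaleTheta.MuTwoSetting.nonempty_cLevelData_modelχq' :
    Nonempty (MuTwoSetting.modelχq' p i j hj).CLevelData :=
  ⟨MuTwoSetting.modelχq'_cLevelData p i j hj⟩

/-- **The cusped stage-2 Def. 1.7 record HAS A CUSP.** [cite: MochizukiEtTh2009, §1 p.13] -/
theorem exists_isCusp_muTwo_modelχq' :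
    ∃ x : (MuTwoSetting.modelχq' p i j hj).Pt, (MuTwoSetting.modelχq' p i j hj).IsCusp x :=
  ⟨(), trivial⟩

/-- Its decomposition group is `cuspDecompχq p i j = b^Ẑ ⋊ G_{ℚ_p} ≤ Π^tp_X`. [cite: MochizukiEtTh2009, §1 p.13] -/
theorem decomp_muTwo_modelχq'_eq (x : (MuTwoSetting.modelχq' p i j hj).Pt) :
    (MuTwoSetting.modelχq' p i j hj).decomp x = cuspDecompχq p i j := rfl

include hj in
/-- **Joint satisfiability over the cusped stage-2 carrier**: for every `i` and even `j`, a `MuTwoSetting` over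
`curveχq′ p i j` with C-level data, the guard, `Compat`, an admissible `ε_Z`, and A CUSP.
[cite: MochizukiEtTh2009, Def 1.7 p.27] -/
theorem _root_.Literature.AnabelianGeometry.EtaleTheta.MuTwoSetting.exists_tate_cLevelData_and_isCusp_and_isAdmissibleEpsZ :
    ∃ (M : MuTwoSetting p) (_ : M.CLevelData) (εZ : M.GtpC), M.toTemperedCurve = curveχq' p i j ∧
      M.toThetaSetting.IsEtThOrigin ∧ M.toThetaSetting.Compat ∧ M.IsAdmissibleEpsZ εZ ∧ ∃ x : M.Pt, M.IsCusp x :=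
  ⟨MuTwoSetting.modelχq' p i j hj, MuTwoSetting.modelχq'_cLevelData p i j hj, epsZCq p i j, rfl,
    MuTwoSetting.modelχq'_isEtThOrigin p i j hj, MuTwoSetting.modelχq'_compat p i j hj,
    MuTwoSetting.modelχq'_isAdmissibleEpsZ p i j hj, ⟨(), trivial⟩⟩

end Literature.AnabelianGeometry.EtaleTheta.SettingModel

end
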